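import Literature.NumberTheory.GaloisCohomology.Howard2004.ConjugationDatumDeltaProofs
import Literature.NumberTheory.GaloisCohomology.Howard2004.DVRSettingEngineLocalInputsProofs
import HarnessLib

/-!
# Howard 2004, §1.3 H.4 at an inert Kolyvagin prime: the datum letter `hδ` («`e(u, δ_λ w) = e(w, δ_λ u)`»)
# from the cyclotomic character of `δ_λ` — for EVERY `ConjugationDatum` (theorems only)

Topic `NumberTheory/GaloisCohomology/Howard2004`.  THEOREMS ONLY: no definition, no named fact, no instance, no
notation, no `sorry`.  B. Howard, *The Heegner point Kolyvagin system*, Compositio Math. **140** (2004) =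
arXiv:1202.6340, §1.3 H.4 (p. 7 L69–82: the pairing `T × Tw(T) → R(1)`, `(s^σ, t^{τστ⁻¹}) = (s,t)^σ`) and §1.3
(p. 7 L44–48: the transport along conjugation by `τ` with its inner ambiguity `δ_v`).  The cell's G87 engine binder
`h159` (`DVRSettingEngineH159Proofs.engine_h159`) carries the datum letter

  `hδ : ∀ k v, v ∈ S.enginePrimes k → ∀ u w : T^{(k)}, e_k(u, ρ_k(δ_v) w) = e_k(w, ρ_k(δ_v) u)`.

THIS FILE reduces it, for EVERY conjugation datum, to the cyclotomic character of `δ_v` read in the level ring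
(bsd-line-x10b-p1-w5 g9's currency `hχ`, supplied by its `datum_hχ`):
* (input, bsd-line-x10b-p1-w5 g9's `ConjugationDatumDeltaProofs.conj_delta_mul_delta_mem_range_absGaloisRestrict`)
  at a place with `σ v = v`, `τ⁻¹δ_vτ · δ_v = σ̃_v²` (`σ̃_v = τ ∘ δ_v`, `τ` involutive) fixes the prime `𝔓_v` of
  `\bar ℤ_K` ([NSW] 12.1.3 in the tree), hence lies in `D_{𝔓_v} = res Γ_{K_v}`;
* §1 `DVRSetting.ρ_conj_δ_mul_δ_apply` — so it acts trivially on `T^{(k)}` at an engine prime (HTRIV);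
* §2 **`DVRSetting.datum_hδ_of_hχ`** — H.4's `symm` + `equivariant` at `g := δ_v` + §1:
  `e(w, δu) = e(δu, w) = e(δu, (τ⁻¹δτ)(δ w)) = χ(δ) e(u, δw) = e(u, δw)` once `χ(δ_v) = 1` in `R_k` (`hχ`).

Cell `pub/bsd-print-x9`, print leaf G87 `thm161_dvrKolyvaginBound` (stub `stub_h161` of stmt-BirchSwinnertonDyer-22642);
seat `bsd-line-x9-p1-w4` g17, brick (hδ-ALG) (split agreed with bsd-line-x10b-p1-w5 g9, who supplies `hχ`).
`thm161_dvrKolyvaginBound` is NOT proved here; no summit statement is proved; the Birch–Swinnerton-Dyer conjecture is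
not proved by any of this.
References: [Howard2004HeegnerKolyvagin] §1.3 H.4; [NeukirchSchmidtWingberg2008] Cor. 12.1.3; [NeukirchANT1999] Ch. I §9.
-/

set_option autoImplicit false

noncomputable section

open Function NumberField IsDedekindDomain Field
open scoped NumberField Pointwise

namespace Literature.NumberTheory.GaloisCohomology.Howard2004

open Literature.NumberTheory.GaloisRepresentations

/-! ## On a `DVRSetting`: trivial action of `τ⁻¹δ_vτ · δ_v` on `T^{(k)}`, and `hδ` from `χ(δ_v) = 1` -/

namespace DVRSetting

variable {p : ℕ} [Fact p.Prime] {K : Type} [Field K] [NumberField K]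
  {R : Type} [CommRing R] [IsDomain R] [IsDiscreteValuationRing R] [Algebra ℤ_[p] R]
  {N : ℕ → Type} [∀ k, AddCommGroup (N k)] [∀ k, TopologicalSpace (N k)]
  [∀ k, DiscreteTopology (N k)] [∀ k, Module R (N k)]
  {Rk : ℕ → Type} [∀ k, CommRing (Rk k)] [∀ k, IsLocalRing (Rk k)] [∀ k, TopologicalSpace (Rk k)]
  [∀ k, DiscreteTopology (Rk k)] [∀ k, Algebra ℤ_[p] (Rk k)] [∀ k, Algebra R (Rk k)]
  [∀ k, Module (Rk k) (N k)] [∀ k, IsScalarTower R (Rk k) (N k)]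
  {Nbar : Type} [AddCommGroup Nbar] [TopologicalSpace Nbar] [DiscreteTopology Nbar]
  [∀ k, Module (Rk k) Nbar]
  {Nq : ℕ → Finset (HeightOneSpectrum (𝓞 K)) → Type} [∀ k n, AddCommGroup (Nq k n)]
  [∀ k n, TopologicalSpace (Nq k n)] [∀ k n, DiscreteTopology (Nq k n)]
  [∀ k n, Module (Rk k) (Nq k n)] [∀ k n, Module R (Nq k n)]
  [∀ k n, IsScalarTower R (Rk k) (Nq k n)]

/-- **`τ⁻¹δ_vτ · δ_v` acts trivially on `T^{(k)}` at an engine prime `v ∈ 𝓛^{(2k-1)}`** (it lies in `res Γ_{K_v}`,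
which acts trivially there: HTRIV). [cite: Howard2004HeegnerKolyvagin, §1.3 and §1.6 (arXiv:1202.6340 p. 7 L44–48, p. 11 L33–38)] -/
theorem ρ_conj_δ_mul_δ_apply (S : DVRSetting p K R N Rk Nbar Nq) (hy : S.SatisfiesH) {k : ℕ}
    {v : HeightOneSpectrum (𝓞 K)} (hv : v ∈ S.enginePrimes k) (x : N k) :
    (S.T.ρ k) (S.cd.conj (S.cd.δ v) * S.cd.δ v) x = x := by
  obtain ⟨g, hg⟩ := S.cd.conj_delta_mul_delta_mem_range_absGaloisRestrict (S.sigma_smul_eq_self_of_mem_L hy hv.1)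
  have hn : (↑({v} : Finset (HeightOneSpectrum (𝓞 K))) : Set (HeightOneSpectrum (𝓞 K))) ⊆ S.enginePrimes k := by
    rw [Finset.coe_singleton, Set.singleton_subset_iff]; exact hv
  have hek : 0 < S.e k := hy.e_zero.trans_le (hy.e_strictMono.monotone (Nat.zero_le k))
  have h := S.toLocal_apply_eq_self_of_subset_enginePrimes hy (k := k) (j := k) (by omega) hn
    (Finset.mem_singleton_self v) g x
  rw [GaloisRep.toLocal_apply] at h
  change (S.T.ρ k) (absGaloisRestrict K (v.adicCompletion K) g) x = x at h
  rwa [show absGaloisRestrict K (v.adicCompletion K) g = S.cd.conj (S.cd.δ v) * S.cd.δ v from hg] at h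

/-- **The datum letter `hδ` of `engine_h159` from the cyclotomic character of `δ_v`, for EVERY conjugation datum.**
At an engine prime `v ∈ 𝓛^{(2k-1)}` and `u, w ∈ T^{(k)}`:
`e(w, δu) = e(δu, w)` (H.4 symmetric) `= e(δu, (τ⁻¹δτ)(δw))` (§1) `= χ(δ) · e(u, δw)` (H.4 equivariance at `g = δ_v`)
`= e(u, δw)` by `hχ : χ(δ_v) = 1` in `R_k` (bsd-line-x10b-p1-w5's `datum_hχ`).  No perfectness is used.
[cite: Howard2004HeegnerKolyvagin, §1.3 H.4 (arXiv:1202.6340 p. 7 L69–82) with Lemma 1.5.7 / Prop. 1.5.9 (p. 10)] -/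
theorem datum_hδ_of_hχ (S : DVRSetting p K R N Rk Nbar Nq) (hy : S.SatisfiesH)
    (hχ : ∀ (k : ℕ) (v : HeightOneSpectrum (𝓞 K)), v ∈ S.enginePrimes k →
      algebraMap ℤ_[p] (Rk k) (((GaloisRep.cyclotomicCharacter K p (S.cd.δ v) : ℤ_[p]ˣ) : ℤ_[p])) = 1) :
    ∀ (k : ℕ) (v : HeightOneSpectrum (𝓞 K)), v ∈ S.enginePrimes k → ∀ u w : N k,
      (S.D k).e u ((S.T.ρ k) (S.cd.δ v) w) = (S.D k).e w ((S.T.ρ k) (S.cd.δ v) u) := by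
  intro k v hv u w
  have htriv : (S.T.ρ k) (S.cd.conj (S.cd.δ v)) ((S.T.ρ k) (S.cd.δ v) w) = w := by
    rw [← Module.End.mul_apply, ← map_mul]
    exact S.ρ_conj_δ_mul_δ_apply hy hv w
  have heq := (S.D k).equivariant (S.cd.δ v) u ((S.T.ρ k) (S.cd.δ v) w)
  rw [htriv, hχ k v hv, one_mul] at heq
  rw [(S.D k).symm w, heq]

end DVRSetting

end Literature.NumberTheory.GaloisCohomology.Howard2004

end
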